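import Summits.CriticalPhenomena.CardyFormulaZ2.Theorems.CardyAnchoredRigiditySubseqCardyStubCountableApproxBondNearCrude
import Summits.CriticalPhenomena.CardyFormulaZ2.Theorems.CardyFlipRussoCoveringLegStubCoveringBridgeSandwich
import Literature.Probability.Percolation.LatticeSymmetry
import Literature.Probability.Percolation.LatticeTraceGeometry

/-!
# Crude bond-`ℤ²` crossing probabilities under translations of the domain
# (crux `SubseqCardy`, stmt-CriticalPhenomena-5768, line `registered`: structure of joint limits, part 1)

Route `CardyAnchoredRigidity` (decl shared with `CardyLocalRigidity`), sub-problem `CardyFormulaZ2`.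
Support file for the structure theory of the JOINT SEQUENTIAL LIMITS `g` of the bond-`ℤ²` crossing
probabilities (the objects of the two open stubs S2 `stub_limitConformal` / S3
`stub_conformalLimitIsCardy`): the two facts about TRANSLATIONS of the domain that the translation
invariance of every joint limit (part 2, `…SubseqCardyJointLimitSymmetry.lean`) rests on, stated for
the crude standard-embedding crossing probability `bondStdCrossingProb R δ =
P_{1/2}[embDomainCrossing squareLatticeEmbedding.z Ω δ (ab) (cd)]` (G02's `bondDomainCrossingProb R`
is asymptotically `bondStdCrossingProb R (·/√2)`, `stub_bondNearCrude`).

* `bondStdCrossingProb_map_addLeft_lattice` — EXACT invariance under translations by vectors of the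
  crude lattice `δ · z(ℤ²)` (`z = squareLatticeEmbedding.z`): the three index sets of the crude event
  of the translated rectangle are the lattice translates of those of `R`, and `P_{1/2}` is invariant
  under lattice translations (`real_openCrossing_shift`; monotonicity of crossing events in window
  and targets is the tree's `cover_openCrossing_mono`).
* `crude_translate_perturb` — MESH-UNIFORM STABILITY UNDER SMALL TRANSLATIONS, UNIFORMLY IN THE
  TRANSLATION: for every conformal rectangle `R` and `ε > 0` there is `l > 0` such that for all small
  meshes `δ` and ALL vectors `‖e‖ ≤ l` at once,
  `|bondStdCrossingProb (e + R) δ - bondStdCrossingProb R δ| ≤ ε`.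
  This is Schramm–Smirnov's domain perturbation (their (5.1), `SchrammSmirnov2011_lemma_5_1_holds`)
  run through the fattened / thinned sandwich of the tree (`upperCrossing_subset_fatQuad_crossing`,
  `thinQuad_crossing_subset_lowerCrossing`, `crude_subset_upperCrossing`,
  `lowerCrossing_subset_embDomainCrossing`) exactly as in `stub_DomainPerturbation`, except that the
  sandwich is only ever instantiated at `R`: the fattened and thinned events are METRIC and a
  translate by `e` of a `ρ`-fattening sits inside the `(ρ + ‖e‖)`-fattening of `R`
  (`upperCrossing_map_addLeft_subset`, `lowerCrossing_subset_map_addLeft`), so the mesh threshold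
  does not depend on `e` — which `stub_DomainPerturbation` (one threshold per homeomorphism) does not
  give.

References: O. Schramm, S. Smirnov, *On the scaling limits of planar percolation*, Ann. Probab. 39
(2011) §1.3, Lemma 5.1, eq. (5.1); G. Grimmett, *Percolation* (1999) §1.6 (translation invariance
of `P_p`).
-/

noncomputable section

namespace Summit.CriticalPhenomena.CardyFormulaZ2.Cruxes.SubseqCardy.Birth

open Set Filter Topology Metric MeasureTheory
open Literature.Probability.RandomPlanarGeometry (ConformalRectangle MarkedDomain)
open Literature.Probability.LatticeModels
open Literature.Probability.Percolation (IsSquareModel exists_isSquareModel BondConfig openEdgeUnion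
  openCrossing openConnIn bondPercolation half embDomainCrossing real_openCrossing_shift)
open Literature.Probability.Percolation.QuadCrossing (Quad)
open Literature.Probability.Percolation.QuadCrossing.Quad (Dominated StrictlyDominated)
open Summit.CriticalPhenomena.CardyFormulaZ2.Theorems.CornerLineDescent.SymmetricSeed (bondStdCrossingProb
  upperCrossing_subset_fatQuad_crossing thinQuad_crossing_subset_lowerCrossing crude_subset_upperCrossing)
open Summit.CriticalPhenomena.CardyFormulaZ2.Theorems.CornerLineDescent.SymmetricSeed.Freeze (upperCrossing
  lowerCrossing sideCollar otherArcs enlarge lowerCrossing_subset_embDomainCrossing exists_radius_left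
  exists_radius_right exists_modulus dist_chartQuad_le chartQuad fatQuad thinQuad tmodel fatQuad_eq
  thinQuad_eq)
open Summit.CriticalPhenomena.CardyFormulaZ2.Cruxes.CoveringLeg.FiveArmNull (cover_openCrossing_mono)

namespace JointLimit

/-! ### Translates of sets: membership and distances -/

/-- `z ∈ e + X ↔ z - e ∈ X`. [folklore] -/
theorem mem_image_addLeft_iff (e : ℂ) (X : Set ℂ) (z : ℂ) :
    z ∈ (fun w => e + w) '' X ↔ z - e ∈ X := by
  constructor
  · rintro ⟨w, hw, rfl⟩
    simpa using hw
  · intro h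
    exact ⟨z - e, h, by ring⟩

/-- Distances to a translate: `infDist z (e + X) = infDist (z - e) X`. [folklore] -/
theorem infDist_image_addLeft (e : ℂ) (X : Set ℂ) (z : ℂ) :
    infDist z ((fun w => e + w) '' X) = infDist (z - e) X := by
  have h := Metric.infDist_image (IsometryEquiv.addLeft e).isometry (x := z - e) (t := X)
  have hf : ((IsometryEquiv.addLeft e) : ℂ → ℂ) = fun w => e + w :=
    funext fun w => IsometryEquiv.addLeft_apply e w
  rw [hf] at h
  simpa using h

/-- The distance to `X` exceeds the distance to the translate `e + X` by at most `‖e‖`. [folklore] -/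
theorem infDist_le_infDist_image_addLeft_add (e : ℂ) (X : Set ℂ) (z : ℂ) :
    infDist z X ≤ infDist z ((fun w => e + w) '' X) + ‖e‖ := by
  rw [infDist_image_addLeft]
  have h := Metric.infDist_le_infDist_add_dist (s := X) (x := z) (y := z - e)
  have hd : dist z (z - e) = ‖e‖ := by
    rw [dist_eq_norm, sub_sub_cancel]
  linarith

/-- A closed ball of radius `ρ` lies in the translate `e + X` as soon as the concentric ball of radius
`ρ + ‖e‖` lies in `X`. [folklore] -/
theorem closedBall_subset_image_addLeft {e z : ℂ} {ρ : ℝ} {X : Set ℂ}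
    (h : closedBall z (ρ + ‖e‖) ⊆ X) : closedBall z ρ ⊆ (fun w => e + w) '' X := by
  intro q hq
  rw [mem_image_addLeft_iff]
  apply h
  rw [mem_closedBall] at hq ⊢
  calc dist (q - e) z ≤ dist (q - e) q + dist q z := dist_triangle _ _ _
    _ = ‖e‖ + dist q z := by rw [dist_eq_norm, sub_sub_cancel_left, norm_neg]
    _ ≤ ρ + ‖e‖ := by linarith

/-! ### The translated rectangle: carrier, arcs, collars -/

/-- The carrier of `e + R`. [folklore] -/
theorem carrier_map_addLeft (R : ConformalRectangle) (e : ℂ) :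
    (R.map (Homeomorph.addLeft e)).carrier = (fun w => e + w) '' R.carrier := by
  rw [MarkedDomain.carrier_map, Homeomorph.coe_addLeft]

/-- The arcs of `e + R`. [folklore] -/
theorem arc_map_addLeft (R : ConformalRectangle) (e : ℂ) (i : Fin 4) :
    (R.map (Homeomorph.addLeft e)).arc i = (fun w => e + w) '' R.arc i := by
  rw [MarkedDomain.arc_map, Homeomorph.coe_addLeft]

/-- The union of the other arcs of `e + R` is the translate of that of `R`. [folklore] -/
theorem otherArcs_map_addLeft (R : ConformalRectangle) (e : ℂ) (i : Fin 4) :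
    otherArcs (R.map (Homeomorph.addLeft e)) i = (fun w => e + w) '' otherArcs R i := by
  simp only [otherArcs, arc_map_addLeft, image_iUnion]

/-- The side collars of `e + R` are the translates of those of `R`. [folklore] -/
theorem sideCollar_map_addLeft (R : ConformalRectangle) (e : ℂ) (i : Fin 4) (κ : ℝ) :
    sideCollar (R.map (Homeomorph.addLeft e)) i κ = (fun w => e + w) '' sideCollar R i κ := by
  ext z
  rw [mem_image_addLeft_iff]
  simp only [sideCollar, mem_setOf_eq, arc_map_addLeft, otherArcs_map_addLeft, infDist_image_addLeft]

/-- The enlarged domain of `e + R` is the translate of that of `R`. [folklore] -/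
theorem enlarge_map_addLeft (R : ConformalRectangle) (e : ℂ) (κ : ℝ) :
    enlarge (R.map (Homeomorph.addLeft e)) κ = (fun w => e + w) '' enlarge R κ := by
  simp only [enlarge, carrier_map_addLeft, sideCollar_map_addLeft, image_union]

/-- `collarᵢ ∖ carrier` of `e + R` is the translate of that of `R`. [folklore] -/
theorem sideCollar_diff_map_addLeft (R : ConformalRectangle) (e : ℂ) (i : Fin 4) (κ : ℝ) :
    sideCollar (R.map (Homeomorph.addLeft e)) i κ \ (R.map (Homeomorph.addLeft e)).carrier =
      (fun w => e + w) '' (sideCollar R i κ \ R.carrier) := by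
  rw [sideCollar_map_addLeft, carrier_map_addLeft, image_sdiff (add_right_injective e)]

/-! ### The metric sandwich events of a translate sit inside those of `R` with enlarged radius -/

/-- THE FATTENED EVENT OF A TRANSLATE: a `ρ`-fattened crude crossing of `e + R` is a
`(ρ + ‖e‖)`-fattened crude crossing of `R` (same mesh, same configuration). [folklore] -/
theorem upperCrossing_map_addLeft_subset (R : ConformalRectangle) (e : ℂ) (ρ δ : ℝ) :
    upperCrossing (R.map (Homeomorph.addLeft e)) ρ δ ⊆ upperCrossing R (ρ + ‖e‖) δ := by
  simp only [upperCrossing, carrier_map_addLeft, arc_map_addLeft]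
  refine cover_openCrossing_mono ?_ ?_ ?_ <;> intro x hx <;> simp only [mem_setOf_eq] at hx ⊢ <;>
    exact (infDist_le_infDist_image_addLeft_add e _ _).trans (by linarith)

/-- THE THINNED EVENT OF A TRANSLATE: a `(ρ + ‖e‖)`-thinned collar-to-collar crossing of `R` is a
`ρ`-thinned collar-to-collar crossing of `e + R` (same collar scale, mesh and configuration).
[folklore] -/
theorem lowerCrossing_subset_map_addLeft (R : ConformalRectangle) (e : ℂ) (κ ρ δ : ℝ) :
    lowerCrossing R κ (ρ + ‖e‖) δ ⊆ lowerCrossing (R.map (Homeomorph.addLeft e)) κ ρ δ := by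
  simp only [lowerCrossing, enlarge_map_addLeft, sideCollar_diff_map_addLeft]
  refine cover_openCrossing_mono ?_ ?_ ?_ <;> intro x hx <;> simp only [mem_setOf_eq] at hx ⊢ <;>
    exact closedBall_subset_image_addLeft hx

/-! ### Exact invariance under translations by crude-lattice vectors -/

/-- The standard embedding is additive: `z (x + v) = z x + z v`. [folklore] -/
theorem z_add (x v : Site 2) :
    squareLatticeEmbedding.z (x + v) = squareLatticeEmbedding.z x + squareLatticeEmbedding.z v := by
  rw [squareLatticeEmbedding_z, squareLatticeEmbedding_z, squareLatticeEmbedding_z,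
    Literature.Probability.Percolation.toComplex_add, mul_add]

/-- An index set defined through the drawn position `δ · z x`, read on the translate by the lattice
vector `δ · z v`, is the translate by `v` of the index set. [folklore] -/
theorem setOf_image_addLeft_lattice (δ : ℝ) (v : Site 2) (P : ℂ → Prop) :
    {x : Site 2 | P ((δ : ℂ) * squareLatticeEmbedding.z x - (δ : ℂ) * squareLatticeEmbedding.z v)} =
      (· + v) '' {x : Site 2 | P ((δ : ℂ) * squareLatticeEmbedding.z x)} := by
  ext x
  simp only [mem_setOf_eq, mem_image]
  constructor
  · intro h
    refine ⟨x - v, ?_, sub_add_cancel x v⟩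
    have e1 : x = (x - v) + v := (sub_add_cancel x v).symm
    rw [e1, z_add, mul_add, add_sub_cancel_right] at h
    exact h
  · rintro ⟨y, hy, rfl⟩
    rwa [z_add, mul_add, add_sub_cancel_right]

/-- **Exact lattice-translation invariance of the crude crossing probability**: translating the
conformal rectangle by a vector `δ · z v` of the crude lattice `δ · z(ℤ²)` does not change
`bondStdCrossingProb · δ` (the crude event of the translate is the lattice translate of the crude
event, and `P_{1/2}` is translation invariant, `real_openCrossing_shift`). [folklore] -/
theorem bondStdCrossingProb_map_addLeft_lattice (R : ConformalRectangle) (δ : ℝ) (v : Site 2) :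
    bondStdCrossingProb (R.map (Homeomorph.addLeft ((δ : ℂ) * squareLatticeEmbedding.z v))) δ =
      bondStdCrossingProb R δ := by
  set a : ℂ := (δ : ℂ) * squareLatticeEmbedding.z v with ha
  have hS : {y : Site 2 | (δ : ℂ) * squareLatticeEmbedding.z y ∈ (fun w => a + w) '' R.carrier} =
      (· + v) '' {y : Site 2 | (δ : ℂ) * squareLatticeEmbedding.z y ∈ R.carrier} := by
    simp only [mem_image_addLeft_iff]
    exact setOf_image_addLeft_lattice δ v (fun p => p ∈ R.carrier)
  have hT : ∀ A : Set ℂ,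
      {u : Site 2 | infDist ((δ : ℂ) * squareLatticeEmbedding.z u) ((fun w => a + w) '' A) ≤ 2 * δ} =
        (· + v) '' {u : Site 2 | infDist ((δ : ℂ) * squareLatticeEmbedding.z u) A ≤ 2 * δ} := by
    intro A
    simp only [infDist_image_addLeft]
    exact setOf_image_addLeft_lattice δ v (fun p => infDist p A ≤ 2 * δ)
  simp only [bondStdCrossingProb, embDomainCrossing, carrier_map_addLeft, arc_map_addLeft]
  rw [hS, hT, hT]
  exact real_openCrossing_shift half v _ _ _

/-! ### Mesh-uniform stability under small translations, uniformly in the translation -/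

/-- **Small translations change the crude crossing probability by at most `ε`, uniformly in the
translation and in the (small) mesh.** For every conformal rectangle `R` and `ε > 0` there is `l > 0`
such that, eventually as the mesh `δ → 0⁺`, for ALL vectors `e` with `‖e‖ ≤ l`,
`|bondStdCrossingProb (e + R) δ - bondStdCrossingProb R δ| ≤ ε`.
Proof: Schramm–Smirnov (5.1) at the model chart quad `Q₀ = Ψ([-1,1]²)` of a square model of `R` gives
`Q' < Q₀ < Q''` with `P_{1/2}[Q' crossed ∧ ¬ Q'' crossed] ≤ ε` for small meshes; the fattened /
thinned sandwich of `R` ALONE (`crude ⊆ upper_ρ`, `upper_{ρ'} ⇒ fat-quad crossing ⇒ Q' crossed`,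
`Q'' crossed ⇒ thin-quad crossing ⇒ lower_{ρ'}`, `lower_ρ ⊆ crude`, all radii `ρ' ≤ ρ + l` below the
sandwich margins) also sandwiches the crude event of every translate `e + R`, `‖e‖ ≤ l`, because
`upper_ρ (e + R) ⊆ upper_{ρ+‖e‖} R` and `lower_{ρ+‖e‖} R ⊆ lower_ρ (e + R)`; hence
`crude (e + R) ⊆ crude R ∪ E ∪ N` and `crude R ⊆ crude (e + R) ∪ E ∪ N` with `P(E) ≤ ε`, `P(N) = 0`.
[cite: SchrammSmirnov2011, §5 Lemma 5.1 and eq. (5.1)] -/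
theorem crude_translate_perturb (R : ConformalRectangle) {ε : ℝ} (hε : 0 < ε) :
    ∃ l : ℝ, 0 < l ∧ ∀ᶠ δ in 𝓝[>] (0:ℝ), ∀ e : ℂ, ‖e‖ ≤ l →
      |bondStdCrossingProb (R.map (Homeomorph.addLeft e)) δ - bondStdCrossingProb R δ| ≤ ε := by
  obtain ⟨Φ, hΦ⟩ := exists_isSquareModel R
  -- Schramm–Smirnov (5.1) at the model chart quad, and the two domination radii
  obtain ⟨Q', Q'', hQ', hQ'', δ₀, hδ₀, hE⟩ :=
    Literature.Probability.Percolation.QuadCrossing.Quad.continuity_of_lemma_5_1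
      Literature.Probability.Percolation.QuadCrossing.SchrammSmirnov2011_lemma_5_1_holds
      (chartQuad (tmodel Φ) (-1) 1 (-1) 1 (by norm_num) (by norm_num)) (ENNReal.ofReal ε)
      (ENNReal.ofReal_pos.2 hε)
  obtain ⟨r₁, hr₁, hdom₁⟩ := exists_radius_left hQ'
  obtain ⟨r₂, hr₂, hdom₂⟩ := exists_radius_right hQ''
  set r : ℝ := min (min r₁ r₂) 1 with hrdef
  have hr : 0 < r := lt_min (lt_min hr₁ hr₂) one_pos
  have hrr₁ : r ≤ r₁ := (min_le_left _ _).trans (min_le_left _ _)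
  have hrr₂ : r ≤ r₂ := (min_le_left _ _).trans (min_le_right _ _)
  have hr4 : 0 < r / 4 := by positivity
  obtain ⟨θ, hθ, hmod⟩ := exists_modulus (tmodel Φ) hr4
  -- the width parameter `s`
  set s : ℝ := min (1 / 2) (θ / 4) with hsdef
  have hs : 0 < s := lt_min one_half_pos (by positivity)
  have hs1 : s ≤ 1 / 2 := min_le_left _ _
  have hsθ : 4 * s ≤ θ := by rw [hsdef]; linarith [min_le_right (1 / 2 : ℝ) (θ / 4)]
  -- the sandwich data of `R` (and of `R` only)
  obtain ⟨g, hg, hup⟩ := upperCrossing_subset_fatQuad_crossing R Φ hΦ s hs hs1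
  obtain ⟨t, ht, hts, κ, hκ, rr, hrr, hlow⟩ := thinQuad_crossing_subset_lowerCrossing R Φ hΦ s hs hs1 s hs
  -- the chart quads of `Ψ` are within `r/4` of the model quad
  have hdistP : dist (chartQuad (tmodel Φ) (-1 + s) (1 - s) (-1 - s) (1 + s) (by linarith) (by linarith))
      (chartQuad (tmodel Φ) (-1) 1 (-1) 1 (by norm_num) (by norm_num)) ≤ r / 4 := by
    refine dist_chartQuad_le hr4.le hmod _ _ ⟨by linarith, by linarith⟩ ⟨by linarith, by linarith⟩
      ⟨by linarith, by linarith⟩ ⟨by linarith, by linarith⟩ ?_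
    have e1 : -1 + s + 1 = s := by ring
    have e2 : 1 - s - 1 = -s := by ring
    have e3 : -1 - s + 1 = -s := by ring
    have e4 : 1 + s - 1 = s := by ring
    rw [e1, e2, e3, e4, abs_neg, abs_of_pos hs]
    linarith
  have hdistM : dist (chartQuad (tmodel Φ) (-1 - t) (1 + t) (-1 + s) (1 - s) (by linarith) (by linarith))
      (chartQuad (tmodel Φ) (-1) 1 (-1) 1 (by norm_num) (by norm_num)) ≤ r / 4 := by
    refine dist_chartQuad_le hr4.le hmod _ _ ⟨by linarith, by linarith⟩ ⟨by linarith, by linarith⟩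
      ⟨by linarith, by linarith⟩ ⟨by linarith, by linarith⟩ ?_
    have e1 : -1 - t + 1 = -t := by ring
    have e2 : 1 + t - 1 = t := by ring
    have e3 : -1 + s + 1 = s := by ring
    have e4 : 1 - s - 1 = -s := by ring
    rw [e1, e2, e3, e4, abs_neg, abs_neg, abs_of_pos hs, abs_of_pos ht]
    linarith
  -- dominations for the chart `Ψ` of `R`
  have hdomP : Dominated Q' (fatQuad (tmodel Φ) s) := by
    rw [fatQuad_eq _ hs (by linarith)]
    exact hdom₁ _ (lt_of_le_of_lt hdistP (by linarith))
  have hdomM : Dominated (thinQuad (tmodel Φ) t s) Q'' := by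
    rw [thinQuad_eq _ ht hs (by linarith)]
    exact hdom₂ _ (lt_of_le_of_lt hdistM (by linarith))
  -- the translation slack and the meshes
  refine ⟨min g rr / 8, by positivity, ?_⟩
  have hδ₁ : 0 < min (min (min g rr / 8) (δ₀ / 2)) (κ / 2) := by positivity
  filter_upwards [Ioo_mem_nhdsGT hδ₁] with δ hδ e he
  rw [mem_Ioo] at hδ
  obtain ⟨hδ, hδ'⟩ := hδ
  have hδgr : δ < min g rr / 8 := hδ'.trans_le ((min_le_left _ _).trans (min_le_left _ _))
  have hδδ₀ : δ < δ₀ / 2 := hδ'.trans_le ((min_le_left _ _).trans (min_le_right _ _))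
  have hδκ : δ < κ / 2 := hδ'.trans_le (min_le_right _ _)
  have hsq2 : Real.sqrt 2 < 2 := by linarith [Real.sqrt_two_lt_three_halves]
  have hsq0 : 0 < Real.sqrt 2 := Real.sqrt_pos.2 two_pos
  have hm2 : δ * Real.sqrt 2 < 2 * δ := by nlinarith
  have hmpos : 0 < δ * Real.sqrt 2 := by positivity
  have hmδ₀ : δ * Real.sqrt 2 < δ₀ := by linarith
  have hκδ : Real.sqrt 2 * δ ≤ κ := by nlinarith
  have hgr_g : min g rr ≤ g := min_le_left _ _
  have hgr_r : min g rr ≤ rr := min_le_right _ _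
  have he0 : 0 ≤ ‖e‖ := norm_nonneg e
  set ρ : ℝ := min g rr / 4 with hρdef
  have hρ : 0 ≤ ρ := by positivity
  have hρe : 0 ≤ ρ + ‖e‖ := by positivity
  have h2δ : 2 * δ ≤ ρ := by rw [hρdef]; linarith
  have hmg : δ * Real.sqrt 2 + ρ ≤ g := by rw [hρdef]; linarith
  have hmr : δ * Real.sqrt 2 + ρ ≤ rr := by rw [hρdef]; linarith
  have hmge : δ * Real.sqrt 2 + (ρ + ‖e‖) ≤ g := by rw [hρdef]; linarith
  have hmre : δ * Real.sqrt 2 + (ρ + ‖e‖) ≤ rr := by rw [hρdef]; linarith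
  set m : ℝ := δ * Real.sqrt 2 with hm
  set P := bondPercolation (zdGraph 2) half with hP
  set E : Set (BondConfig (Site 2)) := {ω | (∃ K, Q'.IsCrossing K ∧ K ⊆ openEdgeUnion m ω) ∧
    ¬ ∃ K, Q''.IsCrossing K ∧ K ⊆ openEdgeUnion m ω} with hEdef
  set G : Set (BondConfig (Site 2)) := {ω | ω ⊆ (zdGraph 2).edgeSet} with hGdef
  set Re : ConformalRectangle := R.map (Homeomorph.addLeft e) with hRe
  set A : Set (BondConfig (Site 2)) :=
    embDomainCrossing squareLatticeEmbedding.z R.carrier δ (R.arc 0) (R.arc 2) with hAdef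
  set AT : Set (BondConfig (Site 2)) :=
    embDomainCrossing squareLatticeEmbedding.z Re.carrier δ (Re.arc 0) (Re.arc 2) with hATdef
  -- the two inclusions of events
  have hinclA : AT ⊆ A ∪ (E ∪ Gᶜ) := by
    intro ω hω
    by_cases hωG : ω ⊆ (zdGraph 2).edgeSet
    swap
    · exact Or.inr (Or.inr hωG)
    have hup' : ω ∈ upperCrossing R (ρ + ‖e‖) δ :=
      upperCrossing_map_addLeft_subset R e ρ δ (crude_subset_upperCrossing Re ρ δ hδ.le h2δ hω)
    obtain ⟨K, hK, hKO⟩ := hup δ (ρ + ‖e‖) hδ hρe hmge ω hωG hup'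
    obtain ⟨K', hK'K, hK'⟩ := hdomP K hK
    by_cases hQ2 : ∃ K, Q''.IsCrossing K ∧ K ⊆ openEdgeUnion m ω
    · obtain ⟨K₂, hK₂, hK₂O⟩ := hQ2
      obtain ⟨K₃, hK₃K, hK₃⟩ := hdomM K₂ hK₂
      exact Or.inl (lowerCrossing_subset_embDomainCrossing R hδ hρ hκδ hωG
        (hlow δ ρ hδ hρ hmr ω K₃ hK₃ (hK₃K.trans hK₂O)))
    · exact Or.inr (Or.inl ⟨⟨K', hK', hK'K.trans hKO⟩, hQ2⟩)
  have hinclB : A ⊆ AT ∪ (E ∪ Gᶜ) := by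
    intro ω hω
    by_cases hωG : ω ⊆ (zdGraph 2).edgeSet
    swap
    · exact Or.inr (Or.inr hωG)
    have hup' : ω ∈ upperCrossing R ρ δ := crude_subset_upperCrossing R ρ δ hδ.le h2δ hω
    obtain ⟨K, hK, hKO⟩ := hup δ ρ hδ hρ hmg ω hωG hup'
    obtain ⟨K', hK'K, hK'⟩ := hdomP K hK
    by_cases hQ2 : ∃ K, Q''.IsCrossing K ∧ K ⊆ openEdgeUnion m ω
    · obtain ⟨K₂, hK₂, hK₂O⟩ := hQ2
      obtain ⟨K₃, hK₃K, hK₃⟩ := hdomM K₂ hK₂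
      refine Or.inl (lowerCrossing_subset_embDomainCrossing Re hδ hρ hκδ hωG ?_)
      exact lowerCrossing_subset_map_addLeft R e κ ρ δ (hlow δ (ρ + ‖e‖) hδ hρe hmre ω K₃ hK₃ (hK₃K.trans hK₂O))
    · exact Or.inr (Or.inl ⟨⟨K', hK', hK'K.trans hKO⟩, hQ2⟩)
  -- the measures
  have hGc : P.real Gᶜ = 0 := by
    rw [measureReal_def, ENNReal.toReal_eq_zero_iff]
    left
    have hae := Literature.Probability.Percolation.ae_subset_edgeSet (zdGraph 2) half
    rw [Filter.Eventually, MeasureTheory.mem_ae_iff] at hae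
    exact hae
  have hEε : P.real E ≤ ε := ENNReal.toReal_le_of_le_ofReal hε.le (hE m hmpos hmδ₀)
  have hEG : P.real (E ∪ Gᶜ) ≤ ε :=
    calc P.real (E ∪ Gᶜ) ≤ P.real E + P.real Gᶜ := measureReal_union_le _ _
      _ ≤ ε := by rw [hGc, add_zero]; exact hEε
  have hA : P.real AT ≤ P.real A + ε :=
    calc P.real AT ≤ P.real (A ∪ (E ∪ Gᶜ)) := measureReal_mono hinclA
      _ ≤ P.real A + P.real (E ∪ Gᶜ) := measureReal_union_le _ _
      _ ≤ P.real A + ε := by gcongr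
  have hB : P.real A ≤ P.real AT + ε :=
    calc P.real A ≤ P.real (AT ∪ (E ∪ Gᶜ)) := measureReal_mono hinclB
      _ ≤ P.real AT + P.real (E ∪ Gᶜ) := measureReal_union_le _ _
      _ ≤ P.real AT + ε := by gcongr
  show |P.real AT - P.real A| ≤ ε
  rw [abs_sub_le_iff]
  constructor <;> linarith

end JointLimit

/-- **Registered sub-goal `stub_crudeTranslatePerturb` (line `registered`, lead c3) — translation-uniform
Schramm–Smirnov perturbation of the crude bond-`ℤ²` crossing probability**, `JointLimit.crude_translate_perturb`
with `bondStdCrossingProb` unfolded: for every conformal rectangle `R` and `ε > 0` there is `l > 0` such that,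
eventually as `δ → 0⁺`, for all `‖e‖ ≤ l`,
`|P_{1/2}[crude crossing of e + R at mesh δ] - P_{1/2}[crude crossing of R at mesh δ]| ≤ ε`.
[cite: SchrammSmirnov2011, §5 Lemma 5.1 and eq. (5.1)] -/
theorem stub_crudeTranslatePerturb : ∀ (R : Literature.Probability.RandomPlanarGeometry.ConformalRectangle) (ε : ℝ), 0 < ε → ∃ l : ℝ, 0 < l ∧ ∀ᶠ δ in nhdsWithin (0 : ℝ) (Set.Ioi 0), ∀ e : ℂ, ‖e‖ ≤ l → |(Literature.Probability.Percolation.bondPercolation (Literature.Probability.LatticeModels.zdGraph 2) Literature.Probability.Percolation.half).real (Literature.Probability.Percolation.embDomainCrossing Literature.Probability.LatticeModels.squareLatticeEmbedding.z (R.map (Homeomorph.addLeft e)).carrier δ ((R.map (Homeomorph.addLeft e)).arc 0) ((R.map (Homeomorph.addLeft e)).arc 2)) - (Literature.Probability.Percolation.bondPercolation (Literature.Probability.LatticeModels.zdGraph 2) Literature.Probability.Percolation.half).real (Literature.Probability.Percolation.embDomainCrossing Literature.Probability.LatticeModels.squareLatticeEmbedding.z R.carrier δ (R.arc 0) (R.arc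 2))| ≤ ε :=
  fun R _ hε => JointLimit.crude_translate_perturb R hε

end Summit.CriticalPhenomena.CardyFormulaZ2.Cruxes.SubseqCardy.Birth

end
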